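import Mathlib
import Literature.Computability.AlgebraicComplexity.SymmetricArithCircuit
import Summits.ValiantsHypothesis.ValiantsHypothesis.Theorems.MonotoneRestorationOrbitRestorationQPHereditaryTerms
import HarnessLib

/-!
# The reduced symmetric circuit of a closed universe of normal terms (construction and symmetry)

Route MonotoneRestoration, crux `OrbitRestorationQP` (stmt-ValiantsHypothesis-18293) — K3 machinery, namespace
`Summit.ValiantsHypothesis.ValiantsHypothesis.Theorems.TermCircuit`.

Given a finite set `𝒯` of hereditary `{+, ×}`-terms in normal form (`HTerm.normalize`, file
`…MonotoneRestorationOrbitRestorationQPHereditaryTerms.lean`) which is closed under children, whose product nodes are binary and whose sum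
nodes are nonempty, this file builds ONE Dawar–Wilsenach labelled arithmetic circuit
(`LabelledArithCircuit`, Def. 2.2: children are SETS of gates) whose gates are the node-terms of `𝒯`
— so that hereditarily AC-equal sub-computations are ONE gate — together with three multiplicity
gadgets realising repeated summands / the square of a factor without duplicating structure:

* `Zr` — the unary product of the constant `0` (value `0`);
* `Pl u` — the sum `u + Zr` (a second gate with the value of `u`);
* `Sc m u` — the product `(m : K) · Pl u` (value `m · u`);

a sum node with children multiset `M` is wired to `{u : count 1} ∪ {Sc (count u) u : count ≥ 2}`, a
product node `u₁ u₂` to `{u₁, u₂}` (`u₁ ≠ u₂`) or `{u, Sc 1 u}` (`u₁ = u₂ = u`).  A group `Γ` acting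
on the variables acts on normal terms by `HTerm.act` (rename and renormalise); if `𝒯` is `Γ`-stable the
induced permutation of the gates is a circuit automorphism (`perm_isAutomorphismExtending`), so the
circuit is `Γ`-symmetric with a DESIGNED automorphism over every `γ`.  The companion file
`…MonotoneRestorationOrbitRestorationQPTermCircuitWf.lean` assembles the circuit (acyclicity, input conditions); `…Symmetry.lean` gives
the designed automorphisms, `…Injective.lean` / `…Reduced.lean` prove that the circuit is REDUCED (hence
rigid: its Dawar–Wilsenach orbits are the designed ones, `Literature/…/SymmetricCircuitRigidity.lean`), and
`…Orbit.lean` proves that it computes `HTerm.val` and packages the length-free orbit bound.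

Everything is proved; no named facts. [folklore]

## References
* A. Dawar, G. Wilsenach, *Symmetric arithmetic circuits*, ToC 21 (2025), Defs. 2.2, 3.6, 3.7, §3.3.
  [DawarWilsenach2025]
* A. Dawar, G. Wilsenach, *Symmetric circuits for rank logic*, ACM ToCL 23 (2021/22), §3 (reduced
  circuits). [DawarWilsenach2021]
-/

noncomputable section

open scoped Classical

-- `Summit.ValiantsHypothesis.ValiantsHypothesis.…` is the tree's single-conjunct layout (Sub = Summit).
set_option linter.dupNamespace false

namespace Summit.ValiantsHypothesis.ValiantsHypothesis.Theorems

open Literature.Computability.AlgebraicComplexity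

namespace TermCircuit

open HTerm

universe u v

variable {K : Type u} {X : Type v}

/-- **A closed universe of normal terms**: a finite set of hereditary terms in normal form, closed
under children, with binary product nodes, nonempty sum nodes, multiplicities of summands bounded by
`M`, and a distinguished node `root`. [folklore] -/
structure Universe (K : Type u) (X : Type v) where
  /-- The terms. -/
  T : Finset (HTerm K X)
  /-- The multiplicity bound. -/
  M : ℕ
  /-- The distinguished output term. -/
  root : HTerm K X
  normal : ∀ t ∈ T, normalize t = t
  closed : ∀ (b : Bool) (l : List (HTerm K X)), node b l ∈ T → ∀ u ∈ l, u ∈ T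
  binary : ∀ l : List (HTerm K X), node true l ∈ T → l.length = 2
  nonempty : ∀ l : List (HTerm K X), node false l ∈ T → l ≠ []
  count_le : ∀ l : List (HTerm K X), node false l ∈ T → ∀ u, l.count u ≤ M
  one_le : 1 ≤ M
  root_mem : root ∈ T
  root_node : ∃ (b : Bool) (l : List (HTerm K X)), root = node b l

variable (𝒰 : Universe K X)

/-- The node-terms of the universe (the internal gates). [folklore] -/
def nodes : Finset (HTerm K X) := 𝒰.T.filter fun t => ∃ (b : Bool) (l : List (HTerm K X)), t = node b l

/-- The constants needed: constant leaves of the universe and the multiplicities `0, …, M`. [folklore] -/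
def consts [Semiring K] : Finset K :=
  (𝒰.T.biUnion fun t => match t with
    | const c => {c}
    | _ => ∅) ∪ (Finset.range (𝒰.M + 1)).image fun m : ℕ => (m : K)

/-- A constant leaf of the universe is a needed constant. [folklore] -/
theorem mem_consts_of_const_mem [Semiring K] {c : K} (h : const c ∈ 𝒰.T) : c ∈ consts 𝒰 := by
  refine Finset.mem_union_left _ (Finset.mem_biUnion.2 ⟨const c, h, ?_⟩)
  simp

/-- The multiplicities are needed constants. [folklore] -/
theorem natCast_mem_consts [Semiring K] {m : ℕ} (h : m ≤ 𝒰.M) : (m : K) ∈ consts 𝒰 :=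
  Finset.mem_union_right _ (Finset.mem_image.2 ⟨m, Finset.mem_range.2 (by omega), rfl⟩)

/-! ### Gates -/

/-- The gates: variables, the needed constants, one gate per node-term, the scaled copies `Sc m u`,
the plain copies `Pl u`, and the zero gadget `Zr`. [folklore] -/
inductive Gate [Semiring K] (𝒰 : Universe K X) : Type (max u v)
  | V (x : X) : Gate 𝒰
  | C (c : ↥(consts 𝒰)) : Gate 𝒰
  | T (t : ↥(nodes 𝒰)) : Gate 𝒰
  | Sc (m : Fin (𝒰.M + 1)) (u : ↥𝒰.T) : Gate 𝒰
  | Pl (u : ↥𝒰.T) : Gate 𝒰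
  | Zr : Gate 𝒰

variable [CommSemiring K]

/-- Finitely many gates (for finitely many variables). [folklore] -/
instance Gate.instFintype [Fintype X] : Fintype (Gate 𝒰) := by
  classical
  exact Fintype.ofEquiv (X ⊕ ↥(consts 𝒰) ⊕ ↥(nodes 𝒰) ⊕ (Fin (𝒰.M + 1) × ↥𝒰.T) ⊕ ↥𝒰.T ⊕ Unit)
    { toFun := fun s => match s with
        | Sum.inl x => Gate.V x
        | Sum.inr (Sum.inl c) => Gate.C c
        | Sum.inr (Sum.inr (Sum.inl t)) => Gate.T t
        | Sum.inr (Sum.inr (Sum.inr (Sum.inl ⟨m, u⟩))) => Gate.Sc m u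
        | Sum.inr (Sum.inr (Sum.inr (Sum.inr (Sum.inl u)))) => Gate.Pl u
        | Sum.inr (Sum.inr (Sum.inr (Sum.inr (Sum.inr _)))) => Gate.Zr
      invFun := fun g => match g with
        | Gate.V x => Sum.inl x
        | Gate.C c => Sum.inr (Sum.inl c)
        | Gate.T t => Sum.inr (Sum.inr (Sum.inl t))
        | Gate.Sc m u => Sum.inr (Sum.inr (Sum.inr (Sum.inl ⟨m, u⟩)))
        | Gate.Pl u => Sum.inr (Sum.inr (Sum.inr (Sum.inr (Sum.inl u))))
        | Gate.Zr => Sum.inr (Sum.inr (Sum.inr (Sum.inr (Sum.inr ()))))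
      left_inv := fun s => by rcases s with x | c | t | ⟨m, u⟩ | u | ⟨⟩ <;> rfl
      right_inv := fun g => by cases g <;> rfl }

/-- The gate of a member term: a variable or constant input, or the node gate (junk `Zr` off the
universe). [folklore] -/
def gateOf (u : HTerm K X) : Gate 𝒰 :=
  match u with
  | var x => Gate.V x
  | const c => if h : c ∈ consts 𝒰 then Gate.C ⟨c, h⟩ else Gate.Zr
  | node b l => if h : node b l ∈ nodes 𝒰 then Gate.T ⟨node b l, h⟩ else Gate.Zr

/-- The representative of a summand `u` of multiplicity `m`: `u` itself for `m = 1`, the scaled copy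
`Sc m u` otherwise (junk `Zr` off range). [folklore] -/
def rep (u : HTerm K X) (m : ℕ) : Gate 𝒰 :=
  if m = 1 then gateOf 𝒰 u
  else if h : u ∈ 𝒰.T ∧ m ≤ 𝒰.M then Gate.Sc ⟨m, by omega⟩ ⟨u, h.1⟩ else Gate.Zr

/-- The square element of a two-element list `[u, u]`, if any. [folklore] -/
def sqElem : List (HTerm K X) → Option (HTerm K X)
  | [u, u'] => if u = u' then some u else none
  | _ => none

/-- Children. [folklore] -/
def children : Gate 𝒰 → Finset (Gate 𝒰)
  | Gate.V _ => ∅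
  | Gate.C _ => ∅
  | Gate.T ⟨node false l, _⟩ => (l.map fun u => rep 𝒰 u (l.count u)).toFinset
  | Gate.T ⟨node true l, _⟩ =>
      match sqElem l with
      | some u => ({gateOf 𝒰 u, if h : u ∈ 𝒰.T then Gate.Sc ⟨1, by have := 𝒰.one_le; omega⟩ ⟨u, h⟩
          else Gate.Zr} : Finset (Gate 𝒰))
      | none => (l.map (gateOf 𝒰)).toFinset
  | Gate.T ⟨var _, _⟩ => ∅
  | Gate.T ⟨const _, _⟩ => ∅
  | Gate.Sc m u =>
      ({Gate.C ⟨((m : ℕ) : K), natCast_mem_consts 𝒰 (Nat.le_of_lt_succ m.2)⟩, Gate.Pl u} :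
        Finset (Gate 𝒰))
  | Gate.Pl u => ({gateOf 𝒰 u.1, Gate.Zr} : Finset (Gate 𝒰))
  | Gate.Zr => ({Gate.C ⟨((0 : ℕ) : K), natCast_mem_consts 𝒰 (Nat.zero_le _)⟩} : Finset (Gate 𝒰))

/-- Labels. [folklore] -/
def label : Gate 𝒰 → CircuitLabel K X
  | Gate.V x => .var x
  | Gate.C c => .const c.1
  | Gate.T ⟨node false _, _⟩ => .add
  | Gate.T ⟨node true _, _⟩ => .mul
  | Gate.T ⟨var _, _⟩ => .add
  | Gate.T ⟨const _, _⟩ => .add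
  | Gate.Sc _ _ => .mul
  | Gate.Pl _ => .add
  | Gate.Zr => .mul

/-- Rank, for acyclicity. [folklore] -/
def rank : Gate 𝒰 → ℕ
  | Gate.V _ => 0
  | Gate.C _ => 0
  | Gate.T t => 4 * t.1.size
  | Gate.Sc _ u => 4 * u.1.size + 3
  | Gate.Pl u => 4 * u.1.size + 2
  | Gate.Zr => 1

/-! ### Basic facts about the structure maps -/

omit [CommSemiring K] in
/-- `sqElem l = some u` forces `l = [u, u]`. [folklore] -/
theorem eq_of_sqElem_eq_some {l : List (HTerm K X)} {u : HTerm K X} (h : sqElem l = some u) :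
    l = [u, u] := by
  match l, h with
  | [a, b], h =>
    simp only [sqElem] at h
    split_ifs at h with hab
    · cases h; subst hab; rfl

omit [CommSemiring K] in
/-- `sqElem` of a two-element list. [folklore] -/
theorem sqElem_pair (a b : HTerm K X) : sqElem [a, b] = if a = b then some a else none := rfl

omit [CommSemiring K] in
/-- `sqElem` depends only on the underlying multiset (for two-element lists). [folklore] -/
theorem sqElem_eq_of_perm_pair {L : List (HTerm K X)} {a b : HTerm K X} (h : L.Perm [a, b]) :
    sqElem L = if a = b then some a else none := by
  have hlen : L.length = 2 := h.length_eq
  obtain ⟨c, d, rfl⟩ := List.length_eq_two.1 hlen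
  rw [sqElem_pair]
  have hcd : ({c, d} : Multiset (HTerm K X)) = {a, b} := Multiset.coe_eq_coe.2 h
  by_cases hab : a = b
  · subst hab
    have hc : c = a := by
      have : c ∈ ({a, a} : Multiset (HTerm K X)) := hcd ▸ Multiset.mem_cons_self c _
      simpa using this
    have hd : d = a := by
      have : d ∈ ({a, a} : Multiset (HTerm K X)) := hcd ▸ (by simp)
      simpa using this
    subst hc; subst hd; simp
  · rw [if_neg hab]
    have hcd' : c ≠ d := by
      rintro rfl
      have : a ∈ ({c, c} : Multiset (HTerm K X)) := hcd.symm ▸ Multiset.mem_cons_self a _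
      have ha : a = c := by simpa using this
      have : b ∈ ({c, c} : Multiset (HTerm K X)) := hcd.symm ▸ (by simp)
      have hb : b = c := by simpa using this
      exact hab (ha.trans hb.symm)
    rw [if_neg hcd']

omit [CommSemiring K] in
/-- Members of `nodes` are nodes. [folklore] -/
theorem exists_eq_node_of_mem_nodes {t : HTerm K X} (h : t ∈ nodes 𝒰) :
    ∃ (b : Bool) (l : List (HTerm K X)), t = node b l := (Finset.mem_filter.1 h).2

omit [CommSemiring K] in
/-- Members of `nodes` are members. [folklore] -/
theorem mem_T_of_mem_nodes {t : HTerm K X} (h : t ∈ nodes 𝒰) : t ∈ 𝒰.T := (Finset.mem_filter.1 h).1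

omit [CommSemiring K] in
/-- A node of the universe is in `nodes`. [folklore] -/
theorem node_mem_nodes {b : Bool} {l : List (HTerm K X)} (h : node b l ∈ 𝒰.T) : node b l ∈ nodes 𝒰 :=
  Finset.mem_filter.2 ⟨h, b, l, rfl⟩

/-- `gateOf` of a node of the universe. [folklore] -/
theorem gateOf_node {b : Bool} {l : List (HTerm K X)} (h : node b l ∈ 𝒰.T) :
    gateOf 𝒰 (node b l) = Gate.T ⟨node b l, node_mem_nodes 𝒰 h⟩ := by
  simp [gateOf, node_mem_nodes 𝒰 h]

/-- `gateOf` of a constant of the universe. [folklore] -/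
theorem gateOf_const {c : K} (h : const c ∈ 𝒰.T) :
    gateOf 𝒰 (const c) = Gate.C ⟨c, mem_consts_of_const_mem 𝒰 h⟩ := by
  simp [gateOf, mem_consts_of_const_mem 𝒰 h]

/-- `rep u m` for `2 ≤ m ≤ M` and `u` in the universe is the scaled copy. [folklore] -/
theorem rep_of_ne_one {u : HTerm K X} {m : ℕ} (hu : u ∈ 𝒰.T) (hm : m ≠ 1) (hmM : m ≤ 𝒰.M) :
    rep 𝒰 u m = Gate.Sc ⟨m, by omega⟩ ⟨u, hu⟩ := by
  simp [rep, hm, hu, hmM]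

/-- `rep u 1 = gateOf u`. [folklore] -/
theorem rep_one (u : HTerm K X) : rep 𝒰 u 1 = gateOf 𝒰 u := by simp [rep]

/-- Children of a sum-node gate (stated for a propositionally known term). [folklore] -/
theorem children_T_sum (t : ↥(nodes 𝒰)) (l : List (HTerm K X)) (ht : t.1 = node false l) :
    children 𝒰 (Gate.T t) = (l.map fun u => rep 𝒰 u (l.count u)).toFinset := by
  obtain ⟨t, h⟩ := t
  subst ht
  rfl

/-- Children of a product-node gate. [folklore] -/
theorem children_T_prod (t : ↥(nodes 𝒰)) (l : List (HTerm K X)) (ht : t.1 = node true l) :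
    children 𝒰 (Gate.T t) =
      match sqElem l with
      | some u => ({gateOf 𝒰 u, if h : u ∈ 𝒰.T then Gate.Sc ⟨1, by have := 𝒰.one_le; omega⟩ ⟨u, h⟩
          else Gate.Zr} : Finset (Gate 𝒰))
      | none => (l.map (gateOf 𝒰)).toFinset := by
  obtain ⟨t, h⟩ := t
  subst ht
  rfl

/-- Children of a square node `u · u`. [folklore] -/
theorem children_T_sq (t : ↥(nodes 𝒰)) (a : HTerm K X) (ht : t.1 = node true [a, a]) (ha : a ∈ 𝒰.T) :
    children 𝒰 (Gate.T t) =
      ({gateOf 𝒰 a, Gate.Sc ⟨1, by have := 𝒰.one_le; omega⟩ ⟨a, ha⟩} : Finset (Gate 𝒰)) := by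
  obtain ⟨t, h⟩ := t
  subst ht
  simp [children, sqElem, ha]

/-- Children of a product node with two distinct factors. [folklore] -/
theorem children_T_pair (t : ↥(nodes 𝒰)) (a c : HTerm K X) (ht : t.1 = node true [a, c]) (hac : a ≠ c) :
    children 𝒰 (Gate.T t) = ({gateOf 𝒰 a, gateOf 𝒰 c} : Finset (Gate 𝒰)) := by
  obtain ⟨t, h⟩ := t
  subst ht
  simp [children, sqElem, hac]

/-- Label of a sum-node gate. [folklore] -/
theorem label_T_sum (t : ↥(nodes 𝒰)) (l : List (HTerm K X)) (ht : t.1 = node false l) :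
    label 𝒰 (Gate.T t) = .add := by
  obtain ⟨t, h⟩ := t
  subst ht
  rfl

/-- Label of a product-node gate. [folklore] -/
theorem label_T_prod (t : ↥(nodes 𝒰)) (l : List (HTerm K X)) (ht : t.1 = node true l) :
    label 𝒰 (Gate.T t) = .mul := by
  obtain ⟨t, h⟩ := t
  subst ht
  rfl

omit [CommSemiring K] in
/-- `toFinset` of a list mapped into terms is the image of its `toFinset`. [folklore] -/
theorem toFinset_map_term {α : Type*} [DecidableEq α] (f : α → HTerm K X) (l : List α) :
    (l.map f).toFinset = l.toFinset.image f := by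
  ext b
  simp [List.mem_toFinset]

/-- `toFinset` of a list mapped into the gates is the image of its `toFinset`. [folklore] -/
theorem toFinset_map_gate {α : Type*} [DecidableEq α] (f : α → Gate 𝒰) (l : List α) :
    (l.map f).toFinset = l.toFinset.image f := by
  ext b
  simp [List.mem_toFinset]

end TermCircuit

end Summit.ValiantsHypothesis.ValiantsHypothesis.Theorems

end
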